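import Summits.ResolutionOfSingularities.ResolutionOfSingularities.Theorems.EquisingularLiftEquisingularLiftNatBlowupChartPointOfPrime
import Literature.AlgebraicGeometry.Resolution.BlowupAlgebraQuasiRegularChart
import Literature.AlgebraicGeometry.Resolution.BlowupAlgebraPresentation
import Literature.AlgebraicGeometry.Resolution.GenericPointStalkData
import HarnessLib

/-!
# [OURS · L1 W4.5(b) · EL♮(3)] (δ) D3a POINT-DICT — a cluster point `(i t, a t)` of the tangent cone IS a point `y′_t ∈ υ⁻¹{x}` of the
# blown-up special fibre, with its chart presentation (the maximal chart prime `𝔮_t = (𝔪_x, c̄_l/c̄_{i t} − ã_l)`)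

Crux chain w45b (cell `res-hironaka`, slot W4.5(b)), working crux **EL♮** = stmt-ResolutionOfSingularities-20038, child **EL♮(3)** =
stmt-ResolutionOfSingularities-20148, route EquisingularLift, rung v7′ (TC⁺⁺) / (δ) = TC⁺⁺ STEP 0 PER SUBSET (res-L1-w45b-stub-3
`DELTA-PLAN.md` §D3). Object (δ) D3 POINT-DICT was cut by res-L1-w45b-plan-1 (D3 CUT RULING 2026-08-27T17:01:20Z) into D3a (this file,
res-D-pv-051) · D3b (transport along stub-3's D2 frame change) · D3c (COVER ⇒ `Cand ⊆ range y′`, res-L1-w45b-stub-2). HONEST FRAMING: OURS;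
NOT a statement of any manuscript; AI-written, weaker than expert review. No `sorry`; standard axioms. DEF-FREE.
`--supports stmt-ResolutionOfSingularities-20148 --as helper`.

SETTING (the `CarrierCluster₂` letters, p547095 / …NatClusterStepDefs): `υ : F₂ → F₁` the blow-up of the closed point `x`, a frame
`c : Fin 3 → 𝒪_{F₁,x}` (quasi-regular), a residue model `πk : 𝒪_{F₁,x} ↠ k'` with `ker πk = (c)`, and ONE cluster point: a chart index
`jj : Fin 3` and affine coordinates `a : {l // l ≠ jj} → k'` (the point `â = [… : 1 : …]` of `ℙ²_{k'} = υ⁻¹{x}`), with chosen lifts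
`w l ∈ 𝒪_{F₁,x}`, `πk (w l) = a l`.

* `exists_chartPrime_of_coords` — the CHART PRIME `𝔮 ⊂ B = 𝒪_{F₁,x}[𝔪_x/c_jj]` of the cluster point: the kernel of
  `B → B/(c_jj) ≅ (𝒪/(c))[T_{l ≠ jj}] → k'[T] → k'`, `T_l ↦ a_l` (`blowupAlgebraQuotEquiv`, Stacks 0BIQ); it is MAXIMAL, lies over `𝔪_x`,
  and contains the numerators `c_l/c_jj − w_l`;
* **`exists_clusterPoint_presentation`** — D3a: the point `y′ ∈ F₂` with `υ y′ = x` and the chart presentation of `𝒪_{F₂,y′}` as the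
  localisation of `B` at `𝔮` (`χ` extending `υ^♯`, `IsLocalization.AtPrime`, `e : 𝒪_{F₂,y′} ≃+* B_𝔮`, `𝔮 ∩ 𝒪_{F₁,x} = 𝔪_x`, `𝔮` maximal,
  `c_l/c_jj − w_l ∈ 𝔮`) — res-L1-w45b-stub-2's `exists_point_presentation_of_blowupAlgebra_prime` (p526020 family) at `𝔮`, in the
  T-FRAME-AT presentation currency (p527425) so that D3b/D4 consume it by name. Closedness of `y′` is NOT claimed here (the `Cand` points
  D3c maps onto `range y′` are closed by definition of `Cand`; a finite-type argument would give it in general).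

References: Stacks 0BIQ / 0804 [StacksProject]; Görtz–Wedhorn I (13.19) [GortzWedhorn2020]; tree `BlowupAlgebraQuasiRegularChart`
(`blowupAlgebraQuotEquiv`), `BlowupAlgebraPresentation` (`blowupAlgebra.frac`), `…NatBlowupChartPointOfPrime` (stub-2).
-/

set_option linter.dupNamespace false -- mandated namespace `Summit.<Summit>.<Problem>` of this single-conjunct summit

noncomputable section

open CategoryTheory AlgebraicGeometry TopologicalSpace IsLocalRing
open Literature.AlgebraicGeometry.Resolution
open AlgebraicGeometry.Scheme.IdealSheafData

namespace Summit.ResolutionOfSingularities.ResolutionOfSingularities.Cruxes.EquisingularLiftNat.Sections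

/-! ## The chart prime of a cluster point -/

section ChartPrime

/-- **The chart prime of a cluster point.** For a local ring `R` with a quasi-regular frame `c = (c₀, c₁, c₂)` and a residue model
`πk : R ↠ k'` of kernel `(c)` (so `(c) = 𝔪_R`), a chart `jj` and coordinates `a_l ∈ k'` (`l ≠ jj`) with lifts `w_l`: there is a MAXIMAL
ideal `𝔮` of the affine blowup algebra `B = R[(c)/c_jj]` lying over `𝔪_R` and containing the numerators `c_l/c_jj − w_l` — the kernel of
`B → B/(c_jj) ≅ (R/(c))[T_{l ≠ jj}] → k'`, `T_l ↦ a_l`. [cite: StacksProject, Tag 0BIQ] -/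
theorem exists_chartPrime_of_coords {R : Type} [CommRing R] [IsLocalRing R] (c : Fin 3 → R) (hc : IsQuasiRegular c)
    {k' : Type} [Field k'] (πk : R →+* k') (hπk : Function.Surjective πk) (hker : RingHom.ker πk = Ideal.span (Set.range c))
    (jj : Fin 3) (a : {l : Fin 3 // l ≠ jj} → k') (w : {l : Fin 3 // l ≠ jj} → R) (hw : ∀ l, πk (w l) = a l) :
    ∃ 𝔮 : PrimeSpectrum (blowupAlgebra (Ideal.span (Set.range c)) (c jj)),
      𝔮.asIdeal.IsMaximal ∧
      𝔮.asIdeal.comap (algebraMap R (blowupAlgebra (Ideal.span (Set.range c)) (c jj))) = maximalIdeal R ∧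
      ∀ l : {l : Fin 3 // l ≠ jj}, blowupAlgebra.frac c jj l.1 - algebraMap R _ (w l) ∈ 𝔮.asIdeal := by
  classical
  -- the residue model factors through `R/(c)`
  have hkerle : ∀ r ∈ Ideal.span (Set.range c), πk r = 0 := fun r hr => by
    rw [← RingHom.mem_ker, hker]; exact hr
  let πbar : (R ⧸ Ideal.span (Set.range c)) →+* k' := Ideal.Quotient.lift _ πk hkerle
  have hπbar : ∀ r, πbar (Ideal.Quotient.mk _ r) = πk r := fun r => Ideal.Quotient.lift_mk _ _ _
  -- `ψ : B → k'`
  let ψ : blowupAlgebra (Ideal.span (Set.range c)) (c jj) →+* k' :=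
    (MvPolynomial.eval a).comp ((MvPolynomial.map πbar).comp
      ((blowupAlgebraQuotEquiv c jj hc).symm.toRingHom.comp (Ideal.Quotient.mk _)))
  have hψC : ∀ r, ψ (algebraMap R _ r) = πk r := by
    intro r
    change MvPolynomial.eval a (MvPolynomial.map πbar ((blowupAlgebraQuotEquiv c jj hc).symm
      (Ideal.Quotient.mk _ (algebraMap R _ r)))) = πk r
    have h := blowupAlgebraQuotEquiv_C c jj hc r
    rw [← h, RingEquiv.symm_apply_apply, MvPolynomial.map_C, MvPolynomial.eval_C, hπbar]
  have hψX : ∀ l : {l : Fin 3 // l ≠ jj}, ψ (blowupAlgebra.frac c jj l.1) = a l := by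
    intro l
    change MvPolynomial.eval a (MvPolynomial.map πbar ((blowupAlgebraQuotEquiv c jj hc).symm
      (Ideal.Quotient.mk _ (blowupAlgebra.frac c jj l.1)))) = a l
    have h := blowupAlgebraQuotEquiv_X c jj hc l
    rw [← h, RingEquiv.symm_apply_apply, MvPolynomial.map_X, MvPolynomial.eval_X]
  have hψsurj : Function.Surjective ψ := fun b => by
    obtain ⟨r, hr⟩ := hπk b
    exact ⟨algebraMap R _ r, by rw [hψC, hr]⟩
  have hmax : (RingHom.ker ψ).IsMaximal := RingHom.ker_isMaximal_of_surjective ψ hψsurj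
  refine ⟨⟨RingHom.ker ψ, hmax.isPrime⟩, hmax, ?_, fun l => ?_⟩
  · -- over `𝔪_R`: `ψ ∘ algebraMap = πk`, whose kernel `(c)` is maximal
    have hcomp : ψ.comp (algebraMap R (blowupAlgebra (Ideal.span (Set.range c)) (c jj))) = πk := RingHom.ext hψC
    change (RingHom.ker ψ).comap (algebraMap R _) = maximalIdeal R
    rw [RingHom.comap_ker, hcomp]
    have hkmax : (RingHom.ker πk).IsMaximal := RingHom.ker_isMaximal_of_surjective πk hπk
    exact IsLocalRing.eq_maximalIdeal hkmax
  · change blowupAlgebra.frac c jj l.1 - algebraMap R _ (w l) ∈ RingHom.ker ψ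
    rw [RingHom.mem_ker, map_sub, hψX, hψC, hw, sub_self]

end ChartPrime

/-! ## D3a: the point of the blown-up special fibre under a cluster point -/

section Point

variable {F₁ F₂ : Scheme.{0}} {υ : F₂ ⟶ F₁} {x : F₁}

/-- **(δ) D3a — A CLUSTER POINT IS A POINT OF `υ⁻¹{x}` WITH ITS CHART PRESENTATION.** Let `υ : F₂ → F₁` be the blow-up of the closed
point `x`, `c : Fin 3 → 𝒪_{F₁,x}` a quasi-regular frame, `πk : 𝒪_{F₁,x} ↠ k'` a residue model of kernel `(c)`, and `(jj, a)` a cluster point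
with lifts `w` of its coordinates. Then there are a point `y′ ∈ F₂` over `x` and a presentation of `𝒪_{F₂,y′}` as the localisation of
`B = 𝒪_{F₁,x}[𝔪_x/c_jj]` at a maximal prime `𝔮` over `𝔪_x` containing the `c_l/c_jj − w_l` — in the currency of res-type-100's T-FRAME-AT
(p527425) / res-L1-w45b-stub-2's point-prime dictionary (p526020, p540294). [cite: StacksProject, Tag 0804]
[OURS · L1 W4.5b] (δ) D3a; NOT a statement of the manuscript. -/
theorem exists_clusterPoint_presentation (hx : IsClosed ({x} : Set F₁)) (hυ : IsBlowup υ (vanishingIdeal ⟨{x}, hx⟩))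
    (c : Fin 3 → F₁.presheaf.stalk x) (hc : IsQuasiRegular c) {k' : Type} [Field k'] (πk : F₁.presheaf.stalk x →+* k')
    (hπk : Function.Surjective πk) (hker : RingHom.ker πk = Ideal.span (Set.range c)) (jj : Fin 3)
    (a : {l : Fin 3 // l ≠ jj} → k') (w : {l : Fin 3 // l ≠ jj} → F₁.presheaf.stalk x) (hw : ∀ l, πk (w l) = a l) :
    ∃ (𝔮 : PrimeSpectrum (blowupAlgebra (Ideal.span (Set.range c)) (c jj))) (y' : F₂) (hy' : υ y' = x)
      (χ : blowupAlgebra (Ideal.span (Set.range c)) (c jj) →+* F₂.presheaf.stalk y')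
      (e : F₂.presheaf.stalk y' ≃+* Localization.AtPrime 𝔮.asIdeal),
      (∀ r, χ (algebraMap _ _ r) = (υ.stalkMap y').hom ((F₁.presheaf.stalkCongr (.of_eq hy'.symm)).hom r)) ∧
      @IsLocalization.AtPrime _ _ (F₂.presheaf.stalk y') _ χ.toAlgebra 𝔮.asIdeal _ ∧
      (∀ b, e (χ b) = algebraMap _ (Localization.AtPrime 𝔮.asIdeal) b) ∧
      𝔮.asIdeal.comap (algebraMap _ (blowupAlgebra (Ideal.span (Set.range c)) (c jj))) = maximalIdeal (F₁.presheaf.stalk x) ∧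
      𝔮.asIdeal.IsMaximal ∧
      ∀ l : {l : Fin 3 // l ≠ jj}, blowupAlgebra.frac c jj l.1 - algebraMap _ _ (w l) ∈ 𝔮.asIdeal := by
  classical
  obtain ⟨𝔮, hmax, hcomap, hfrac⟩ := exists_chartPrime_of_coords c hc πk hπk hker jj a w hw
  -- `(c) = 𝔪_x = 𝓘({x})_x`
  have hkmax : (RingHom.ker πk).IsMaximal := RingHom.ker_isMaximal_of_surjective πk hπk
  have hspan : Ideal.span (Set.range c) = maximalIdeal (F₁.presheaf.stalk x) := by
    rw [← hker]; exact IsLocalRing.eq_maximalIdeal hkmax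
  have hcl : (⟨{x}, hx⟩ : Closeds F₁) = ⟨closure {x}, isClosed_closure⟩ := Closeds.ext hx.closure_eq.symm
  have hcJ : Ideal.span (Set.range c) = stalkIdeal (vanishingIdeal ⟨{x}, hx⟩) x := by
    rw [hspan, hcl, stalkIdeal_vanishingIdeal_closure_self]
  obtain ⟨y', hy', χ, e, hχ, he⟩ := exists_point_presentation_of_blowupAlgebra_prime hυ x c hcJ jj 𝔮 hcomap
  -- the localisation structure along `χ`, transported from `B_𝔮` through `e`
  letI := χ.toAlgebra
  have hloc : IsLocalization.AtPrime (F₂.presheaf.stalk y') 𝔮.asIdeal := by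
    refine IsLocalization.isLocalization_of_algEquiv 𝔮.asIdeal.primeCompl
      (AlgEquiv.ofRingEquiv (f := e.symm) fun b => ?_)
    rw [RingEquiv.symm_apply_eq]
    exact (he b).symm
  exact ⟨𝔮, y', hy', χ, e, hχ, hloc, he, hcomap, hmax, hfrac⟩

end Point

end Summit.ResolutionOfSingularities.ResolutionOfSingularities.Cruxes.EquisingularLiftNat.Sections

end
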